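/-
Copyright (c) 2026 the pub-hodgecm-mathlib formalisation cell (harness21).  Prover seat hodgecm-mathlib-K2Liu-p12 (g3): Track B «K2-LIT»,
#184♮ = hLiu418 = stmt-HodgeConjecture-24832; #42S payer road, organ S1, LAST FILE of K2Liu-p01 (g8), brick (B5) «the index `q^{4m}` of the dual boxes».
-/
import Summits.HodgeConjecture.HodgeConjecture.Theorems.K2LiuLocalSWDualBoxes                    -- ★ (B) the boxes (this seat)
import Summits.HodgeConjecture.HodgeConjecture.Theorems.K2LiuLocalBallIndices                     -- ★ (B5) inputs `[𝔭^m : 𝔭^{m+1}] = q` (this seat)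
import Summits.HodgeConjecture.HodgeConjecture.Theorems.K2LiuUnipDeltaRankOneCoordinates          -- ★ `existsUnique_coord_of_conjLocal_eq_neg`, `conjLocal_coord`, `isUnit_algebraMap_delta`
import Summits.HodgeConjecture.HodgeConjecture.Theorems.K2LiuLatticePairCellCount                 -- ★ (T3-core) `natCard_quotient_ker`
import Summits.HodgeConjecture.HodgeConjecture.Theorems.K2LiuGoodPlaceWhittakerUnimodularValueCM   -- ★ E7 `residueCard_eq_sq_of_inert` (this seat)
import Literature.NumberTheory.GelbartRogawski1991.LocalDoubledUnitaryBigCellValue                -- ★ `gramS_map_conj`, `gramS_transpose`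
import Literature.NumberTheory.Automorphic.Liu2021.LemD1DataOfPlace                                -- ★ `conjLocal_conjLocal_apply`
import Literature.NumberTheory.Automorphic.AdicCompletionResidueCard                               -- ★ `residueFieldCard_adicCompletion_eq`
import HarnessLib

/-!
# Crux `HLiu418`, organ S1, brick (B5): THE INDEX OF THE DUAL BOXES ON THE SKEW LATTICE — `[𝔰 ∩ Λ_{k+1} : 𝔰 ∩ Λ_k] = q_v⁴` AT AN INERT UNRAMIFIED PLACE

Cell `hodgecm-mathlib`, crux item hLiu418 = `stmt-HodgeConjecture-24832`, route of record `HCCMUnconditional`; squad K2 ∕ K2Liu, road `K2_Liu`, #42S payer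
road, organ S1; consumer = K2Liu-p01 (g8)'s LAST FILE (★ (J) `K2LiuInertTransportedProfileSum.sum_profile_eq_shape`, letter
`hcard : Fintype.card (S₁ ⧸ S₀.addSubgroupOf S₁) = q ^ (4 * m)`).  THEOREMS ONLY (no `def`, no `instance`, no `notation`, no named-fact hypothesis, no `sorry`);
lane `--supports stmt-HodgeConjecture-24832` (count-neutral helper; closes no socket by itself).

THE MATHEMATICS.  `𝕋 := T₀ ⊗ 1`, `𝔰 = {t : (σt)ᵀ𝕋 + 𝕋t = 0}` (E5's letter `(S) (hS)`), `K := 𝕋t`.  §1: `t ∈ 𝔰 ⟺ σ(K) = −Kᵀ` (`𝕋ᵀ = 𝕋`, `σ𝕋 = 𝕋`): the diagonal entries of `K`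
are `σ`-anti-fixed, hence `K_ii = ι(b_i)·δ̂` with a unique `b_i ∈ L⁺_v` (★ `existsUnique_coord_of_conjLocal_eq_neg`), and `K_10 = −σ(K_01)`.  The box ★ (B)
`BOX m = {t : ∀ i j w, |(δ̂K)_ij|_w ≤ |ι_wϖ|_w^{c₀−m−[i=j]e₂}}` reads, `δ̂` being a `v`-unit, `b_i ∈ 𝔭_v^{c₀−m−e₂}` and `K_01 ∈ 𝔭_{w₀}^{c₀−m}` (inert unramified `v`: one place
`w₀`, `|ι_{w₀}ϖ| = exp(−1)`; `|ι_w y|_w = |y|_v^{e}`).  §2: the additive map `t ↦ (b₀, b₁, (K_01)_{w₀})` from `𝔰 ∩ Λ_{k+1}` to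
`(𝔭_v^{a}⁄𝔭_v^{a+1})² × 𝔭_{w₀}^{a′}⁄𝔭_{w₀}^{a′+1}` (`a = c₀−k−1−e₂`, `a′ = c₀−k−1`) is ONTO with kernel `𝔰 ∩ Λ_k` (lift `(b₀,b₁,z)` to `t = 𝕋⁻¹·(ιb₀δ̂, z; −σz, ιb₁δ̂)`), so
★ (T3-core) `natCard_quotient_ker` and ★ (B5-inputs) `[𝔭^a : 𝔭^{a+1}] = q` give **`[𝔰 ∩ Λ_{k+1} : 𝔰 ∩ Λ_k] = q_v · q_v · q_{w₀} = q_v⁴`** (`q_{w₀} = q_v²`, ★ E7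
`residueCard_eq_sq_of_inert`); §3 iterates to `[𝔰 ∩ Λ_m : 𝔰 ∩ Λ_0] = q_v^{4m}` = the consumer's `hcard` (`AddSubgroup.relIndex` is `Nat.card` of the quotient by definition).
HONEST LABEL.  Count-neutral helper; it retires nothing by itself: `HC_CM` is proved only modulo the 7 printed citations (2 remaining named inputs:
hLiu418 = `stmt-HodgeConjecture-24832`, h413 = `stmt-HodgeConjecture-24833`) until rung 0 closes.

## References
* [Shimura1997] G. Shimura, CBMS 93 (1997): §13.2–§13.5 (hermitian matrices over local fields, dual lattices).
* [BushnellHenniart2006] C. Bushnell, G. Henniart, *The Local Langlands Conjecture for GL(2)* (2006): §1.1.   * [WeilBNT1967] A. Weil, *Basic Number Theory*: Ch. I §4.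
-/

set_option autoImplicit false
-- the mandated namespace repeats the single-problem summit's segment (`HodgeConjecture.HodgeConjecture`)
set_option linter.dupNamespace false

noncomputable section

open scoped NNReal ENNReal Topology Matrix
open NumberField IsDedekindDomain Matrix MeasureTheory Set
open Literature.NumberTheory.GaloisRepresentations.IsNonarchimedeanLocalField
open Literature.NumberTheory.Automorphic Literature.NumberTheory.Automorphic.UnitaryGroup
open Literature.NumberTheory.GelbartRogawski1991.AdaptedBlocks
open Literature.NumberTheory.GelbartRogawski1991.UnitaryDualPair.LocalSplitting
open Literature.NumberTheory.K2Lit.LocalSiegelDoubled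
open Literature.NumberTheory.Automorphic.Liu2021.LemD1OfPlace (conjLocal_conjLocal_apply)
open Summit.HodgeConjecture.HodgeConjecture.Cruxes.HLiu418.K2LiuLocalRingValuationBalls
open Summit.HodgeConjecture.HodgeConjecture.Cruxes.HLiu418.K2LiuUnipDeltaRankOneCoordinates
open Summit.HodgeConjecture.HodgeConjecture.Cruxes.HLiu418.K2LiuLatticePairCellCount (natCard_quotient_ker)
open Summit.HodgeConjecture.HodgeConjecture.Cruxes.HLiu418.K2LiuLocalBallIndices
open Summit.HodgeConjecture.HodgeConjecture.Cruxes.HLiu418.K2LiuLocalSWDualBoxes (box_mono)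
open Summit.HodgeConjecture.HodgeConjecture.Cruxes.HLiu418.K2LiuGoodPlaceWhittakerUnimodularValueCM (residueCard_eq_sq_of_inert)

namespace Summit.HodgeConjecture.HodgeConjecture.Cruxes.HLiu418.K2LiuLocalSWDualBoxIndex

variable (F : Type) [Field F] [NumberField F] (E : Type) [Field E] [NumberField E] [Algebra F E] [Algebra.IsQuadraticExtension F E]
  (c : E ≃ₐ[F] E) {δ : E} (hcδ : c δ = -δ) (hδ : δ ≠ 0)
  (v : HeightOneSpectrum (𝓞 F)) {π : v.adicCompletion F} (hπ : Valued.v π = WithZero.exp (-1 : ℤ))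
  {T₀ : Matrix (Fin 2) (Fin 2) F} (hT₀ : T₀.IsSymm) (hT₀d : IsUnit T₀.det)
  (S : AddSubgroup (Matrix (Fin 2) (Fin 2) (LocalRing E v)))
  (hS : ∀ t, t ∈ S ↔ (t.map (conjLocal E c v))ᵀ * gramS F E v 2 T₀ + gramS F E v 2 T₀ * t = 0)

/-! ## §1 Skewness in the coordinates `K = 𝕋t`; the diagonal coordinates `b_i`; ball bridges -/

omit [Algebra.IsQuadraticExtension F E] in
include hT₀ in
/-- **`t ∈ 𝔰 ⟺ σ(𝕋t) = −(𝕋t)ᵀ`** (`𝕋ᵀ = 𝕋` ★ `gramS_transpose`, `σ𝕋 = 𝕋` ★ `gramS_map_conj`). [cite: Shimura1997, §13.5] -/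
theorem map_conj_mul_eq_neg_transpose_iff (t : Matrix (Fin 2) (Fin 2) (LocalRing E v)) :
    (t.map (conjLocal E c v))ᵀ * gramS F E v 2 T₀ + gramS F E v 2 T₀ * t = 0 ↔
      (gramS F E v 2 T₀ * t).map (conjLocal E c v) = -(gramS F E v 2 T₀ * t)ᵀ := by
  have hTt : (gramS F E v 2 T₀)ᵀ = gramS F E v 2 T₀ := gramS_transpose F E v 2 hT₀
  have hTσ : (gramS F E v 2 T₀).map (conjLocal E c v) = gramS F E v 2 T₀ := gramS_map_conj F E c v 2
  have hkey : (t.map (conjLocal E c v))ᵀ * gramS F E v 2 T₀ = ((gramS F E v 2 T₀ * t).map (conjLocal E c v))ᵀ := by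
    rw [Matrix.map_mul, hTσ, Matrix.transpose_mul, hTt]
  rw [hkey]
  constructor
  · intro h
    have h1 := congrArg Matrix.transpose (eq_neg_of_add_eq_zero_left h)
    rwa [Matrix.transpose_transpose, Matrix.transpose_neg] at h1
  · intro h
    rw [h, Matrix.transpose_neg, Matrix.transpose_transpose, neg_add_cancel]

include hcδ hδ hS hT₀ in
/-- **the diagonal coordinates**: for `t ∈ 𝔰` and `i : Fin 2` there is a unique `b ∈ L⁺_v` with `(𝕋t)_ii = ι(b)·δ̂` (the entry is `σ`-anti-fixed;
★ `existsUnique_coord_of_conjLocal_eq_neg`). [cite: Shimura1997, §13.5] -/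
theorem existsUnique_diag_coord {t : Matrix (Fin 2) (Fin 2) (LocalRing E v)} (ht : t ∈ S) (i : Fin 2) :
    ∃! b : v.adicCompletion F, (gramS F E v 2 T₀ * t) i i = toLocalRing E v b * algebraMap E (LocalRing E v) δ := by
  have h := (map_conj_mul_eq_neg_transpose_iff F E c v hT₀ t).1 ((hS t).1 ht)
  have hii : conjLocal E c v ((gramS F E v 2 T₀ * t) i i) = -((gramS F E v 2 T₀ * t) i i) := by
    have := congrFun (congrFun h i) i
    rwa [Matrix.map_apply, Matrix.neg_apply, Matrix.transpose_apply] at this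
  exact existsUnique_coord_of_conjLocal_eq_neg F E c hcδ hδ v hii

omit [Algebra.IsQuadraticExtension F E] in
include hπ in
/-- **diagonal ball bridge**: `|ι_w(b)·δ̂|_w ≤ |ι_wϖ|_w^a ⟺ b ∈ 𝔭_v^a` (`|δ̂|_w = 1`; `|ι_w y|_w = |y|^{e(w∣v)}` ★ `valued_toPlace`; `|π| = exp(−1)`).
[cite: CasselsFrohlichANT1967, Ch. II §10] -/
theorem valued_coord_le_iff (hδu : ∀ w : PlacesOver E v, Valued.v (algebraMap E (LocalRing E v) δ w) = 1) (a : ℤ) (b : v.adicCompletion F)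
    (w : PlacesOver E v) :
    Valued.v ((toLocalRing E v b * algebraMap E (LocalRing E v) δ) w) ≤ Valued.v (toPlace v w π) ^ a ↔ b ∈ primePowBall (v.adicCompletion F) a := by
  haveI := PlacesOver.liesOver (E := E) w
  have he : v.asIdeal.ramificationIdx' w.1.asIdeal ≠ 0 := Ideal.IsDedekindDomain.ramificationIdx'_ne_zero_of_liesOver w.1.asIdeal v.ne_bot
  have hswap : (Valued.v π ^ v.asIdeal.ramificationIdx' w.1.asIdeal) ^ a = (Valued.v π ^ a) ^ v.asIdeal.ramificationIdx' w.1.asIdeal := by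
    rw [← zpow_natCast, ← zpow_natCast, ← _root_.zpow_mul, ← _root_.zpow_mul, mul_comm]
  have hπa : Valued.v π ^ a = WithZero.exp (-a) := by
    rw [hπ, ← WithZero.exp_zsmul, smul_eq_mul, mul_neg, mul_one]
  rw [Pi.mul_apply, map_mul, hδu w, mul_one, toLocalRing_apply, valued_toPlace, valued_toPlace, hswap,
    pow_le_pow_iff_left₀ zero_le zero_le he, mem_primePowBall_adicCompletion_iff, hπa]

omit [Algebra.IsQuadraticExtension F E] in
/-- **off-diagonal ball bridge at the unramified place `w₀`**: `|z|_{w₀} ≤ |ι_{w₀}ϖ|^a ⟺ z ∈ 𝔭_{w₀}^a` (`|ι_{w₀}ϖ| = exp(−1)`). [cite: CasselsFrohlichANT1967, Ch. II §10] -/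
theorem valued_le_iff_mem_primePowBall {w₀ : PlacesOver E v} (hπw : Valued.v (toPlace v w₀ π) = WithZero.exp (-1 : ℤ)) (a : ℤ) (z : w₀.1.adicCompletion E) :
    Valued.v z ≤ Valued.v (toPlace v w₀ π) ^ a ↔ z ∈ primePowBall (w₀.1.adicCompletion E) a := by
  rw [mem_primePowBall_adicCompletion_iff, hπw, ← WithZero.exp_zsmul, smul_eq_mul, mul_neg, mul_one]

omit [Algebra.IsQuadraticExtension F E] in
include hπ in
/-- **THE BOX IN COORDINATES** (inert unramified `v`, `δ̂` a `v`-unit): for `K = 𝕋t` skew-hermitian with diagonal coordinates `b₀, b₁`,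
`t ∈ BOX m ⟺ b₀, b₁ ∈ 𝔭_v^{c₀−m−e₂} ∧ (K_01)_{w₀} ∈ 𝔭_{w₀}^{c₀−m}` (`K_10 = −σK_01` is then automatic, ★ `ball_conjLocal`). [cite: Shimura1997, §13.5] -/
theorem mem_box_iff_coords {w₀ : PlacesOver E v} [Subsingleton (PlacesOver E v)] (hπw : Valued.v (toPlace v w₀ π) = WithZero.exp (-1 : ℤ))
    (hδu : ∀ w : PlacesOver E v, Valued.v (algebraMap E (LocalRing E v) δ w) = 1) (c₀ e₂ m : ℤ)
    {t : Matrix (Fin 2) (Fin 2) (LocalRing E v)} (hskew : (gramS F E v 2 T₀ * t).map (conjLocal E c v) = -(gramS F E v 2 T₀ * t)ᵀ)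
    {b₀ b₁ : v.adicCompletion F} (hb₀ : (gramS F E v 2 T₀ * t) 0 0 = toLocalRing E v b₀ * algebraMap E (LocalRing E v) δ)
    (hb₁ : (gramS F E v 2 T₀ * t) 1 1 = toLocalRing E v b₁ * algebraMap E (LocalRing E v) δ) :
    t ∈ {t : Matrix (Fin 2) (Fin 2) (LocalRing E v) | ∀ i j (w : PlacesOver E v),
        Valued.v ((algebraMap E (LocalRing E v) δ • (gramS F E v 2 T₀ * t)) i j w) ≤ Valued.v (toPlace v w π) ^ (c₀ - m - if i = j then e₂ else 0)} ↔
      b₀ ∈ primePowBall (v.adicCompletion F) (c₀ - m - e₂) ∧ b₁ ∈ primePowBall (v.adicCompletion F) (c₀ - m - e₂) ∧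
        (gramS F E v 2 T₀ * t) 0 1 w₀ ∈ primePowBall (w₀.1.adicCompletion E) (c₀ - m) := by
  -- `|(δ̂K)_ij|_w = |K_ij|_w`
  have hsm : ∀ i j (w : PlacesOver E v), Valued.v ((algebraMap E (LocalRing E v) δ • (gramS F E v 2 T₀ * t)) i j w) = Valued.v ((gramS F E v 2 T₀ * t) i j w) := by
    intro i j w
    rw [Matrix.smul_apply, smul_eq_mul, Pi.mul_apply, map_mul, hδu w, one_mul]
  -- `K_10 = −σ(K_01)`
  have h10 : (gramS F E v 2 T₀ * t) 1 0 = -conjLocal E c v ((gramS F E v 2 T₀ * t) 0 1) := by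
    have h := congrFun (congrFun hskew 0) 1
    rw [Matrix.map_apply, Matrix.neg_apply, Matrix.transpose_apply] at h
    rw [h, neg_neg]
  rw [Set.mem_setOf_eq]
  constructor
  · intro h
    refine ⟨?_, ?_, ?_⟩
    · have h00 := h 0 0 w₀
      rw [hsm, if_pos rfl, hb₀] at h00
      exact (valued_coord_le_iff F E v hπ hδu _ b₀ w₀).1 h00
    · have h11 := h 1 1 w₀
      rw [hsm, if_pos rfl, hb₁] at h11
      exact (valued_coord_le_iff F E v hπ hδu _ b₁ w₀).1 h11
    · have h01 := h 0 1 w₀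
      rw [hsm, if_neg Fin.zero_ne_one, sub_zero] at h01
      exact (valued_le_iff_mem_primePowBall F E v hπw _ _).1 h01
  · rintro ⟨h0, h1, h01⟩ i j w
    rw [hsm]
    have h01' : ∀ w' : PlacesOver E v, Valued.v ((gramS F E v 2 T₀ * t) 0 1 w') ≤ Valued.v (toPlace v w' π) ^ (c₀ - m) := by
      intro w'
      rw [Subsingleton.elim w' w₀]
      exact (valued_le_iff_mem_primePowBall F E v hπw _ _).2 h01
    fin_cases i <;> fin_cases j
    · show Valued.v ((gramS F E v 2 T₀ * t) 0 0 w) ≤ Valued.v (toPlace v w π) ^ (c₀ - m - if (0 : Fin 2) = 0 then e₂ else 0)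
      rw [if_pos rfl, hb₀]
      exact (valued_coord_le_iff F E v hπ hδu _ b₀ w).2 h0
    · show Valued.v ((gramS F E v 2 T₀ * t) 0 1 w) ≤ Valued.v (toPlace v w π) ^ (c₀ - m - if (0 : Fin 2) = 1 then e₂ else 0)
      rw [if_neg (show (0 : Fin 2) ≠ 1 by decide), sub_zero]
      exact h01' w
    · show Valued.v ((gramS F E v 2 T₀ * t) 1 0 w) ≤ Valued.v (toPlace v w π) ^ (c₀ - m - if (1 : Fin 2) = 0 then e₂ else 0)
      rw [if_neg (show (1 : Fin 2) ≠ 0 by decide), sub_zero, h10]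
      exact ball_neg F E v (ball_conjLocal F E c v h01') w
    · show Valued.v ((gramS F E v 2 T₀ * t) 1 1 w) ≤ Valued.v (toPlace v w π) ^ (c₀ - m - if (1 : Fin 2) = 1 then e₂ else 0)
      rw [if_pos rfl, hb₁]
      exact (valued_coord_le_iff F E v hπ hδu _ b₁ w).2 h1

/-! ## §2 The one-step index `[𝔰 ∩ Λ_{k+1} : 𝔰 ∩ Λ_k] = q_v⁴` -/

include hcδ hδ hT₀ hT₀d in
/-- **the lift**: for `β₀, β₁ ∈ L⁺_v` and `z ∈ E ⊗ L⁺_v`, `t := 𝕋⁻¹·(ι β₀ δ̂, z; −σz, ι β₁ δ̂)` is skew (`σ(𝕋t) = −(𝕋t)ᵀ`) with the prescribed coordinates.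
[cite: Shimura1997, §13.5] -/
theorem exists_skew_with_coords (β₀ β₁ : v.adicCompletion F) (z : LocalRing E v) :
    ∃ t : Matrix (Fin 2) (Fin 2) (LocalRing E v), (gramS F E v 2 T₀ * t).map (conjLocal E c v) = -(gramS F E v 2 T₀ * t)ᵀ ∧
      (gramS F E v 2 T₀ * t) 0 0 = toLocalRing E v β₀ * algebraMap E (LocalRing E v) δ ∧
      (gramS F E v 2 T₀ * t) 1 1 = toLocalRing E v β₁ * algebraMap E (LocalRing E v) δ ∧ (gramS F E v 2 T₀ * t) 0 1 = z := by
  have _ := hT₀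
  obtain ⟨K₀, hK₀⟩ : ∃ K₀ : Matrix (Fin 2) (Fin 2) (LocalRing E v), K₀ =
      !![toLocalRing E v β₀ * algebraMap E (LocalRing E v) δ, z; -conjLocal E c v z, toLocalRing E v β₁ * algebraMap E (LocalRing E v) δ] := ⟨_, rfl⟩
  have hK00 : K₀ 0 0 = toLocalRing E v β₀ * algebraMap E (LocalRing E v) δ := by rw [hK₀]; rfl
  have hK11 : K₀ 1 1 = toLocalRing E v β₁ * algebraMap E (LocalRing E v) δ := by rw [hK₀]; rfl
  have hK01 : K₀ 0 1 = z := by rw [hK₀]; rfl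
  have hK10 : K₀ 1 0 = -conjLocal E c v z := by rw [hK₀]; rfl
  have hTt : gramS F E v 2 T₀ * ((gramS F E v 2 T₀)⁻¹ * K₀) = K₀ := Matrix.mul_nonsing_inv_cancel_left _ K₀ (isUnit_det_gramS' F E v 2 hT₀d)
  refine ⟨(gramS F E v 2 T₀)⁻¹ * K₀, ?_, ?_, ?_, ?_⟩
  · rw [hTt]
    refine Matrix.ext fun i j => ?_
    rw [Matrix.map_apply, Matrix.neg_apply, Matrix.transpose_apply]
    fin_cases i <;> fin_cases j
    · show conjLocal E c v (K₀ 0 0) = -K₀ 0 0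
      rw [hK00]; exact conjLocal_coord F E c hcδ v β₀
    · show conjLocal E c v (K₀ 0 1) = -K₀ 1 0
      rw [hK01, hK10, neg_neg]
    · show conjLocal E c v (K₀ 1 0) = -K₀ 0 1
      rw [hK10, hK01, map_neg, conjLocal_conjLocal_apply E v c hcδ hδ]
    · show conjLocal E c v (K₀ 1 1) = -K₀ 1 1
      rw [hK11]; exact conjLocal_coord F E c hcδ v β₁
  · rw [hTt, hK00]
  · rw [hTt, hK11]
  · rw [hTt, hK01]

include hcδ hδ hπ hT₀ hT₀d hS in
/-- **`[𝔰 ∩ Λ_{k+1} : 𝔰 ∩ Λ_k] = q_v⁴` AT AN INERT UNRAMIFIED PLACE** (`c • w₀ = w₀`, `|ι_{w₀}ϖ| = exp(−1)`; `δ̂` a `v`-unit; `Λ_k, Λ_{k+1}` the ★ (B) boxes by their carriers):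
the coordinate map `t ↦ (b₀, b₁, (K_01)_{w₀})` is an additive surjection `𝔰 ∩ Λ_{k+1} ↠ (𝔭_v^a⁄𝔭_v^{a+1})² × 𝔭_{w₀}^{a′}⁄𝔭_{w₀}^{a′+1}` with kernel `𝔰 ∩ Λ_k`; ★ `natCard_quotient_ker`,
★ `relIndex_eq_residueFieldCard`, `q_{w₀} = q_v²` ★ `residueCard_eq_sq_of_inert`. [cite: Shimura1997, §13.2, §13.5] [cite: BushnellHenniart2006, §1.1] -/
theorem relIndex_inf_box_succ (w₀ : PlacesOver E v) (hw₀ : c • w₀.1 = w₀.1) (hπw : Valued.v (toPlace v w₀ π) = WithZero.exp (-1 : ℤ))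
    (hδu : ∀ w : PlacesOver E v, Valued.v (algebraMap E (LocalRing E v) δ w) = 1) (c₀ e₂ k : ℤ)
    {Λ₀ Λ₁ : AddSubgroup (Matrix (Fin 2) (Fin 2) (LocalRing E v))}
    (hΛ₀ : (Λ₀ : Set (Matrix (Fin 2) (Fin 2) (LocalRing E v))) = {t | ∀ i j (w : PlacesOver E v),
      Valued.v ((algebraMap E (LocalRing E v) δ • (gramS F E v 2 T₀ * t)) i j w) ≤ Valued.v (toPlace v w π) ^ (c₀ - k - if i = j then e₂ else 0)})
    (hΛ₁ : (Λ₁ : Set (Matrix (Fin 2) (Fin 2) (LocalRing E v))) = {t | ∀ i j (w : PlacesOver E v),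
      Valued.v ((algebraMap E (LocalRing E v) δ • (gramS F E v 2 T₀ * t)) i j w) ≤ Valued.v (toPlace v w π) ^ (c₀ - (k + 1) - if i = j then e₂ else 0)}) :
    (S ⊓ Λ₀).relIndex (S ⊓ Λ₁) = v.residueCard ^ 4 := by
  classical
  haveI hsub : Subsingleton (PlacesOver E v) := PlacesOver.subsingleton_of_smul_eq c (galConj_ne_one_of_delta F E c hcδ hδ) w₀ hw₀
  -- the one-dimensional ball subgroups (`a = c₀ − (k+1) − e₂`, `a′ = c₀ − (k+1)`)
  obtain ⟨BF, hBF⟩ := exists_addSubgroup_primePowBall (K := v.adicCompletion F) (c₀ - (k + 1) - e₂)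
  obtain ⟨BF', hBF'⟩ := exists_addSubgroup_primePowBall (K := v.adicCompletion F) (c₀ - (k + 1) - e₂ + 1)
  obtain ⟨BE, hBE⟩ := exists_addSubgroup_primePowBall (K := w₀.1.adicCompletion E) (c₀ - (k + 1))
  obtain ⟨BE', hBE'⟩ := exists_addSubgroup_primePowBall (K := w₀.1.adicCompletion E) (c₀ - (k + 1) + 1)
  -- skewness and the diagonal coordinates on `X := 𝔰 ∩ Λ_{k+1}`
  have hskew : ∀ x : ↥(S ⊓ Λ₁), (gramS F E v 2 T₀ * (x : Matrix (Fin 2) (Fin 2) (LocalRing E v))).map (conjLocal E c v) =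
      -(gramS F E v 2 T₀ * (x : Matrix (Fin 2) (Fin 2) (LocalRing E v)))ᵀ :=
    fun x => (map_conj_mul_eq_neg_transpose_iff F E c v hT₀ _).1 ((hS _).1 (AddSubgroup.mem_inf.1 x.2).1)
  have hex : ∀ (x : ↥(S ⊓ Λ₁)) (i : Fin 2), ∃! b : v.adicCompletion F,
      (gramS F E v 2 T₀ * (x : Matrix (Fin 2) (Fin 2) (LocalRing E v))) i i = toLocalRing E v b * algebraMap E (LocalRing E v) δ :=
    fun x i => existsUnique_diag_coord F E c hcδ hδ v hT₀ S hS (AddSubgroup.mem_inf.1 x.2).1 i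
  choose b hb hbu using hex
  have hmem₁ : ∀ x : ↥(S ⊓ Λ₁), b x 0 ∈ primePowBall (v.adicCompletion F) (c₀ - (k + 1) - e₂) ∧ b x 1 ∈ primePowBall (v.adicCompletion F) (c₀ - (k + 1) - e₂) ∧
      (gramS F E v 2 T₀ * (x : Matrix (Fin 2) (Fin 2) (LocalRing E v))) 0 1 w₀ ∈ primePowBall (w₀.1.adicCompletion E) (c₀ - (k + 1)) := by
    intro x
    have hx : (x : Matrix (Fin 2) (Fin 2) (LocalRing E v)) ∈ (Λ₁ : Set (Matrix (Fin 2) (Fin 2) (LocalRing E v))) := (AddSubgroup.mem_inf.1 x.2).2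
    rw [hΛ₁] at hx
    exact (mem_box_iff_coords F E c v hπ hπw hδu c₀ e₂ (k + 1) (hskew x) (hb x 0) (hb x 1)).1 hx
  have hbadd : ∀ (x y : ↥(S ⊓ Λ₁)) (i : Fin 2), b (x + y) i = b x i + b y i := by
    intro x y i
    refine (hbu (x + y) i (b x i + b y i) ?_).symm
    simp only [AddSubgroup.coe_add, Matrix.mul_add, Matrix.add_apply, hb x i, hb y i, map_add, add_mul]
  -- the coordinate map `f : X →+ (BF⁄BF′)² × BE⁄BE′` (opaque, by its values)
  obtain ⟨f₀, hf₀⟩ : ∃ f₀ : ↥(S ⊓ Λ₁) → ↥BF, ∀ x, (f₀ x : v.adicCompletion F) = b x 0 :=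
    ⟨fun x => ⟨b x 0, by rw [← SetLike.mem_coe, hBF]; exact (hmem₁ x).1⟩, fun x => rfl⟩
  obtain ⟨f₁, hf₁⟩ : ∃ f₁ : ↥(S ⊓ Λ₁) → ↥BF, ∀ x, (f₁ x : v.adicCompletion F) = b x 1 :=
    ⟨fun x => ⟨b x 1, by rw [← SetLike.mem_coe, hBF]; exact (hmem₁ x).2.1⟩, fun x => rfl⟩
  obtain ⟨f₂, hf₂⟩ : ∃ f₂ : ↥(S ⊓ Λ₁) → ↥BE, ∀ x, (f₂ x : w₀.1.adicCompletion E) = (gramS F E v 2 T₀ * x.1) 0 1 w₀ :=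
    ⟨fun x => ⟨(gramS F E v 2 T₀ * x.1) 0 1 w₀, by rw [← SetLike.mem_coe, hBE]; exact (hmem₁ x).2.2⟩, fun x => rfl⟩
  have hf₀add : ∀ x y, f₀ (x + y) = f₀ x + f₀ y := fun x y => Subtype.ext (by rw [AddMemClass.coe_add, hf₀, hf₀, hf₀, hbadd])
  have hf₁add : ∀ x y, f₁ (x + y) = f₁ x + f₁ y := fun x y => Subtype.ext (by rw [AddMemClass.coe_add, hf₁, hf₁, hf₁, hbadd])
  have hf₂add : ∀ x y, f₂ (x + y) = f₂ x + f₂ y := fun x y => Subtype.ext (by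
    rw [AddMemClass.coe_add, hf₂, hf₂, hf₂, AddSubgroup.coe_add, Matrix.mul_add, Matrix.add_apply, Pi.add_apply])
  obtain ⟨f, hfapply⟩ : ∃ f : ↥(S ⊓ Λ₁) →+ (↥BF ⧸ BF'.addSubgroupOf BF) × (↥BF ⧸ BF'.addSubgroupOf BF) × (↥BE ⧸ BE'.addSubgroupOf BE),
      ∀ x, f x = ((f₀ x : ↥BF ⧸ BF'.addSubgroupOf BF), (f₁ x : ↥BF ⧸ BF'.addSubgroupOf BF), (f₂ x : ↥BE ⧸ BE'.addSubgroupOf BE)) :=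
    ⟨AddMonoidHom.mk' (fun x => ((f₀ x : ↥BF ⧸ BF'.addSubgroupOf BF), (f₁ x : ↥BF ⧸ BF'.addSubgroupOf BF), (f₂ x : ↥BE ⧸ BE'.addSubgroupOf BE)))
      (fun x y => by rw [Prod.mk_add_mk, Prod.mk_add_mk, hf₀add, hf₁add, hf₂add, QuotientAddGroup.mk_add, QuotientAddGroup.mk_add, QuotientAddGroup.mk_add]),
     fun x => rfl⟩
  -- its kernel is `𝔰 ∩ Λ_k`
  have hker : f.ker = (S ⊓ Λ₀).addSubgroupOf (S ⊓ Λ₁) := by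
    ext x
    have hbox := mem_box_iff_coords F E c v hπ hπw hδu c₀ e₂ k (hskew x) (hb x 0) (hb x 1)
    rw [AddMonoidHom.mem_ker, hfapply, Prod.mk_eq_zero, Prod.mk_eq_zero, QuotientAddGroup.eq_zero_iff, QuotientAddGroup.eq_zero_iff,
      QuotientAddGroup.eq_zero_iff, AddSubgroup.mem_addSubgroupOf, AddSubgroup.mem_addSubgroupOf, AddSubgroup.mem_addSubgroupOf,
      AddSubgroup.mem_addSubgroupOf, AddSubgroup.mem_inf]
    have e0 : ((f₀ x : ↥BF) : v.adicCompletion F) ∈ BF' ↔ b x 0 ∈ primePowBall (v.adicCompletion F) (c₀ - k - e₂) := by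
      rw [← SetLike.mem_coe, hBF', hf₀, show c₀ - (k + 1) - e₂ + 1 = c₀ - k - e₂ by ring]
    have e1 : ((f₁ x : ↥BF) : v.adicCompletion F) ∈ BF' ↔ b x 1 ∈ primePowBall (v.adicCompletion F) (c₀ - k - e₂) := by
      rw [← SetLike.mem_coe, hBF', hf₁, show c₀ - (k + 1) - e₂ + 1 = c₀ - k - e₂ by ring]
    have e2 : ((f₂ x : ↥BE) : w₀.1.adicCompletion E) ∈ BE' ↔
        (gramS F E v 2 T₀ * x.1) 0 1 w₀ ∈ primePowBall (w₀.1.adicCompletion E) (c₀ - k) := by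
      rw [← SetLike.mem_coe, hBE', hf₂, show c₀ - (k + 1) + 1 = c₀ - k by ring]
    have hx₀ : x.1 ∈ Λ₀ ↔
        b x 0 ∈ primePowBall (v.adicCompletion F) (c₀ - k - e₂) ∧ b x 1 ∈ primePowBall (v.adicCompletion F) (c₀ - k - e₂) ∧
          (gramS F E v 2 T₀ * x.1) 0 1 w₀ ∈ primePowBall (w₀.1.adicCompletion E) (c₀ - k) := by
      rw [← SetLike.mem_coe, hΛ₀]; exact hbox
    rw [e0, e1, e2, hx₀]
    exact ⟨fun h => ⟨(AddSubgroup.mem_inf.1 x.2).1, h.1, h.2.1, h.2.2⟩, fun h => ⟨h.2.1, h.2.2.1, h.2.2.2⟩⟩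
  -- it is onto
  have hsurj : Function.Surjective f := by
    rintro ⟨q₀, q₁, q₂⟩
    obtain ⟨β₀, rfl⟩ := QuotientAddGroup.mk_surjective q₀
    obtain ⟨β₁, rfl⟩ := QuotientAddGroup.mk_surjective q₁
    obtain ⟨ζ, rfl⟩ := QuotientAddGroup.mk_surjective q₂
    obtain ⟨z, hz⟩ : ∃ z : LocalRing E v, z w₀ = (ζ : w₀.1.adicCompletion E) := ⟨Pi.single w₀ (ζ : w₀.1.adicCompletion E), Pi.single_eq_same _ _⟩
    obtain ⟨t, htskew, hb₀', hb₁', h01⟩ := exists_skew_with_coords F E c hcδ hδ v hT₀ hT₀d (β₀ : v.adicCompletion F) (β₁ : v.adicCompletion F) z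
    have h01' : (gramS F E v 2 T₀ * t) 0 1 w₀ = (ζ : w₀.1.adicCompletion E) := by rw [h01, hz]
    have htS : t ∈ S := (hS t).2 ((map_conj_mul_eq_neg_transpose_iff F E c v hT₀ t).2 htskew)
    have hβ₀ : (β₀ : v.adicCompletion F) ∈ primePowBall (v.adicCompletion F) (c₀ - (k + 1) - e₂) := by
      have h := β₀.2; rw [← SetLike.mem_coe, hBF] at h; exact h
    have hβ₁ : (β₁ : v.adicCompletion F) ∈ primePowBall (v.adicCompletion F) (c₀ - (k + 1) - e₂) := by
      have h := β₁.2; rw [← SetLike.mem_coe, hBF] at h; exact h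
    have hζ : (ζ : w₀.1.adicCompletion E) ∈ primePowBall (w₀.1.adicCompletion E) (c₀ - (k + 1)) := by
      have h := ζ.2; rw [← SetLike.mem_coe, hBE] at h; exact h
    have htΛ : t ∈ Λ₁ := by
      rw [← SetLike.mem_coe, hΛ₁]
      exact (mem_box_iff_coords F E c v hπ hπw hδu c₀ e₂ (k + 1) htskew hb₀' hb₁').2 ⟨hβ₀, hβ₁, by rw [h01']; exact hζ⟩
    have hx : t ∈ S ⊓ Λ₁ := AddSubgroup.mem_inf.2 ⟨htS, htΛ⟩
    have e0 : f₀ ⟨t, hx⟩ = β₀ := Subtype.ext (by rw [hf₀]; exact (hbu ⟨t, hx⟩ 0 (β₀ : v.adicCompletion F) hb₀').symm)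
    have e1 : f₁ ⟨t, hx⟩ = β₁ := Subtype.ext (by rw [hf₁]; exact (hbu ⟨t, hx⟩ 1 (β₁ : v.adicCompletion F) hb₁').symm)
    have e2 : f₂ ⟨t, hx⟩ = ζ := Subtype.ext (by rw [hf₂]; exact h01')
    exact ⟨⟨t, hx⟩, by rw [hfapply, e0, e1, e2]⟩
  -- count
  have hcount := natCard_quotient_ker f hsurj
  rw [hker, Nat.card_prod, Nat.card_prod] at hcount
  have hqF : Nat.card (↥BF ⧸ BF'.addSubgroupOf BF) = v.residueCard := by
    rw [← AddSubgroup.index, ← AddSubgroup.relIndex, relIndex_eq_residueFieldCard hBF hBF', residueFieldCard_adicCompletion_eq F v]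
  have hqE : Nat.card (↥BE ⧸ BE'.addSubgroupOf BE) = v.residueCard ^ 2 := by
    rw [← AddSubgroup.index, ← AddSubgroup.relIndex, relIndex_eq_residueFieldCard hBE hBE', residueFieldCard_adicCompletion_eq E w₀.1,
      residueCard_eq_sq_of_inert F E c hcδ hδ v hπ (fun w => by rw [Subsingleton.elim w w₀]; exact hπw) w₀ hw₀]
  rw [AddSubgroup.relIndex, AddSubgroup.index, hcount, hqF, hqE]
  ring

/-! ## §3 `[𝔰 ∩ Λ_m : 𝔰 ∩ Λ_0] = q_v^{4m}` — the consumer's `hcard` -/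

include hcδ hδ hπ hT₀ hT₀d hS in
/-- **`[𝔰 ∩ Λ_m : 𝔰 ∩ Λ_0] = q_v^{4m}`** for the ★ (B) boxes `Λ_j` (given by their carriers), at an inert unramified place: iterate §2 along the nested chain
`𝔰 ∩ Λ_0 ≤ 𝔰 ∩ Λ_1 ≤ … ≤ 𝔰 ∩ Λ_m` (★ `box_mono`, Mathlib `AddSubgroup.relIndex_mul_relIndex`). [cite: Shimura1997, §13.2] [cite: BushnellHenniart2006, §1.1] -/
theorem relIndex_inf_box_eq_pow (w₀ : PlacesOver E v) (hw₀ : c • w₀.1 = w₀.1) (hπw : Valued.v (toPlace v w₀ π) = WithZero.exp (-1 : ℤ))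
    (hδu : ∀ w : PlacesOver E v, Valued.v (algebraMap E (LocalRing E v) δ w) = 1) (c₀ e₂ : ℤ)
    (Λ : ℤ → AddSubgroup (Matrix (Fin 2) (Fin 2) (LocalRing E v)))
    (hΛ : ∀ j : ℤ, (Λ j : Set (Matrix (Fin 2) (Fin 2) (LocalRing E v))) = {t | ∀ i i' (w : PlacesOver E v),
      Valued.v ((algebraMap E (LocalRing E v) δ • (gramS F E v 2 T₀ * t)) i i' w) ≤ Valued.v (toPlace v w π) ^ (c₀ - j - if i = i' then e₂ else 0)})
    (m : ℕ) : (S ⊓ Λ 0).relIndex (S ⊓ Λ m) = v.residueCard ^ (4 * m) := by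
  have hle : ∀ j j' : ℤ, j ≤ j' → S ⊓ Λ j ≤ S ⊓ Λ j' := by
    intro j j' hjj' t ht
    refine AddSubgroup.mem_inf.2 ⟨(AddSubgroup.mem_inf.1 ht).1, ?_⟩
    have h := (AddSubgroup.mem_inf.1 ht).2
    rw [← SetLike.mem_coe, hΛ] at h ⊢
    exact box_mono F E v hπ δ c₀ e₂ hjj' h
  induction m with
  | zero => rw [Nat.cast_zero, AddSubgroup.relIndex_self, mul_zero, pow_zero]
  | succ m ih =>
    have hstep : (S ⊓ Λ m).relIndex (S ⊓ Λ ((m + 1 : ℕ) : ℤ)) = v.residueCard ^ 4 :=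
      relIndex_inf_box_succ F E c hcδ hδ v hπ hT₀ hT₀d S hS w₀ hw₀ hπw hδu c₀ e₂ m (hΛ m) (by rw [hΛ, Nat.cast_succ])
    rw [← AddSubgroup.relIndex_mul_relIndex (S ⊓ Λ 0) (S ⊓ Λ m) (S ⊓ Λ ((m + 1 : ℕ) : ℤ)) (hle _ _ (by positivity)) (hle _ _ (by push_cast; omega)),
      ih, hstep, ← pow_add]
    ring_nf

include hcδ hδ hπ hT₀ hT₀d hS in
/-- **THE `hcard` LETTER OF ★ (J) `K2LiuInertTransportedProfileSum.sum_profile_eq_shape`**: `Fintype.card (𝔰 ∩ Λ_m ⧸ 𝔰 ∩ Λ_0) = q_v^{4m}` (`S₁ := 𝔰 ⊓ Λ_m`, `S₀ := 𝔰 ⊓ Λ_0`;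
`AddSubgroup.relIndex` is the cardinality of this quotient by definition). [cite: Shimura1997, §13.2] [cite: BushnellHenniart2006, §1.1] -/
theorem card_quotient_inf_box_eq_pow (w₀ : PlacesOver E v) (hw₀ : c • w₀.1 = w₀.1) (hπw : Valued.v (toPlace v w₀ π) = WithZero.exp (-1 : ℤ))
    (hδu : ∀ w : PlacesOver E v, Valued.v (algebraMap E (LocalRing E v) δ w) = 1) (c₀ e₂ : ℤ)
    (Λ : ℤ → AddSubgroup (Matrix (Fin 2) (Fin 2) (LocalRing E v)))
    (hΛ : ∀ j : ℤ, (Λ j : Set (Matrix (Fin 2) (Fin 2) (LocalRing E v))) = {t | ∀ i i' (w : PlacesOver E v),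
      Valued.v ((algebraMap E (LocalRing E v) δ • (gramS F E v 2 T₀ * t)) i i' w) ≤ Valued.v (toPlace v w π) ^ (c₀ - j - if i = i' then e₂ else 0)})
    (m : ℕ) [Fintype (↥(S ⊓ Λ m) ⧸ (S ⊓ Λ 0).addSubgroupOf (S ⊓ Λ m))] :
    Fintype.card (↥(S ⊓ Λ m) ⧸ (S ⊓ Λ 0).addSubgroupOf (S ⊓ Λ m)) = v.residueCard ^ (4 * m) := by
  rw [← Nat.card_eq_fintype_card, ← AddSubgroup.index, ← AddSubgroup.relIndex]
  exact relIndex_inf_box_eq_pow F E c hcδ hδ v hπ hT₀ hT₀d S hS w₀ hw₀ hπw hδu c₀ e₂ Λ hΛ m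

end Summit.HodgeConjecture.HodgeConjecture.Cruxes.HLiu418.K2LiuLocalSWDualBoxIndex

end
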